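import Literature.InformationTheory.QuantumCodes.QuantumReedMullerCodes
import Literature.InformationTheory.QuantumCodes.QuantumHammingDecoder
import HarnessLib

/-!
# Shortened quantum Reed–Muller codes: the CSS codes with `X`-checks `ℛ̄(a,m)` and `Z`-checks `ℛ̄(b,m)` on the
# `2^m − 1` nonzero points, `a + b + 1 = m`, are `[[2^m − 1, 1, 2^{min(a,b)+1} − 1]]`; explicit syndrome decoders of
# radius `1` (the Hamming / extended-Hamming rule) for the members with degree-`1` checks of BOTH quantum Reed–Muller
# families (`[[2^m−1,1,3]]`: Steane `[[7,1,3]]`, `[[15,1,3]]`, …; and `[[2^m, 2^m−2m−2, 4]]`: `[[16,6,4]]`, …)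

Topic `Literature/InformationTheory/QuantumCodes`, namespace `Literature.InformationTheory.QuantumCodes.QRM` (venture QEC,
LADDER-QEC cell `qec`, PARTITION row 08, item «08.QRM» file 3; rung Q4: a family with an explicit decoder as a FUNCTION).
Continues `QuantumReedMullerCodes.lean` (the unshortened family on all `2^m` points) and `Coding/ReedMullerDuality.lean`
(`ReedMuller.code`, `monomialFun`, `dualCode_code`, `mem_code_iff_forall_monomialFun`).

**The construction (in print).** Landahl–Cesare 2013 [LandahlCesare2013] (held, arXiv:1302.3240 §6 p. 12, after Def. 2 of
`QRM(r,m)`): «We are most interested in the shortened quantum binary Reed-Muller codes, which we denote by `\overline{QRM}(r,m)`.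
These codes are formed by shortening each of the binary Reed-Muller codes from which it is formed. The process of shortening
first punctures a code by removing a bit on which only row of the generator matrix has support and then expurgates it by
removing the row in the generator matrix that had support on that bit. … In essence, shortening a Reed-Muller code restricts
the space of Boolean polynomials defining the code to those which have no constant term and which also satisfy `p(0) = 0`. …
The parameters of the resulting quantum code are `[[2^m − 1, 1]]`. … Notice that the length of the code `n` does not uniquely
specify which shortened quantum Reed-Muller code one is referring to for `n > 15`.» Anderson–Duclos-Cianci–Poulin 2014
[AndersonDuclosCianciPoulin2014] (held, arXiv:1403.2734 p. 3), the member `r = 1`: «The quantum Reed-Muller codes `QRM(m)`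
derived from `\overline{RM}(1,m)` codes are CSS codes … Elements of `𝒜^x_m` are obtained from rows of `\overline G_m` …
Elements of `𝒜^z_m` are obtained in a similar way, but from the generator matrix of the shortened dual code
`\overline{RM}(m−2,m)`. … the minimum distance of the quantum code is given by the minimum distance of the dual classical
code, which is `d = 3` (Fact 3), so it can correct any single qubit error. … the parameters of the code are
`[[n = 2^m − 1, k = 1, d = 3]]`. The logical operators are … `X̄_m = X^{⊗n}` and `Z̄_m = Z^{⊗n}`.»

**What is here (all PROVED; no named fact, no `sorry`).** On the qubit set `Pt m = 𝔽₂^m ∖ {0}` (`2^m − 1` points) the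
shortened generator matrix `shortGenMatrix m r` has rows = the monomials of degree `1 … r` (no constant term) restricted to
the nonzero points (every such monomial vanishes at `0`), and

* `QRM.shortCode m a b h : CSSCode (MonoPos m a) (MonoPos m b) (Pt m)` (`h : a + b + 1 = m`): `X`-checks `ℛ̄(a,m)`,
  `Z`-checks `ℛ̄(b,m) = ` the shortening of `ℛ(a,m)^⊥` — Landahl–Cesare's `\overline{QRM}(a,m)` (definition);
* the shortening dictionary: `shortGenMatrix_mulVec_eq_zero_iff` (`v ∈ ker ℛ̄(r) ⟺` the EVEN extension of `v` to the point
  `0` lies in `ℛ(s,m)`, `r + s + 1 = m` — the duality theorem), `mem_rowSpace_shortGenMatrix_iff` (`rs ℛ̄(r) =` restrictions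
  of the words of `ℛ(r,m)` vanishing at `0`), `rank_shortGenMatrix` (`= Σ_{i≤r} C(m,i) − 1`);
* **`shortCode_k`** `= 1`, **`shortCode_dZ`** `= 2^{a+1} − 1`, **`shortCode_dX`** `= 2^{b+1} − 1` (both EXACT: a `Z`-logical is
  the restriction of a word of `ℛ(b,m)^⊥ = ℛ(a+1+…)`… precisely of `g ∈ ℛ(m−a−1,m) = ℛ(b,m)`-dual with `g(0) = 1`, so its weight
  is `wt g − 1 ≥ 2^{a+1} − 1`, attained by `g = ∏_{i<b}(1 + x_i)`; mirror for `X`);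
* ★ **`shortCode_isCode`**: `[[2^m − 1, 1, 2^{min(a,b)+1} − 1]]` for every `a + b + 1 = m`, `1 ≤ a`, `1 ≤ b`; members
  `shortCode_7_1_3` (`m = 3`, `a = b = 1`: Steane's code as `\overline{QRM}(1,3)`), `shortCode_15_1_3` (`(4;1,2)` = ADP14's
  15-qubit code, `d_Z = 3 < d_X = 7`), `shortCode_31_1_3` (`(5;1,3)`), `shortCode_31_1_7` (`(5;2,2)`), `shortCode_63_1_7`
  (`(6;2,3)`), `shortCode_127_1_15` (`(7;3,3)`), and ADP14's family `adp_isCode : (shortCode m 1 b _).IsCode (2^m − 1) 1 3`;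
* ★ Q4, EXPLICIT DECODER (row 08): `pointDecode` — read the `m` singleton-monomial syndrome bits as a point `q ∈ 𝔽₂^m`; answer
  `0` if `q = 0`, else the single error at `q` (the Hamming rule); `pointDecode_mulVec_single` (route I: on a single error the
  decoder returns it), **`pointDecode_correctsUpTo_Z`** (`a ≥ 1`: corrects every `Z`-pattern of weight `≤ 1`),
  **`pointDecode_correctsUpTo_X`** (`b ≥ 1`), `adp_decode_radius_optimal` (for ADP14's `[[2^m−1,1,3]]` the explicit pair attains
  the optimal radius `1`: no pair of sector decoders corrects all weight-`2` patterns); generic `shortCode_flatFin_hasOptimalRadius`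
  (`2^{min(a,b)} − 1`, by minimum-weight decoding);
* ★ Q4, EXPLICIT DECODER for the UNSHORTENED family of `QuantumReedMullerCodes.lean`: `extPointDecode` — the extended-Hamming
  rule (all-ones syndrome bit = error parity, coordinate bits = the error's position), `extPointDecode_correctsUpTo_Z/X` (radius `1`
  on `QRM(m;a,b)` with `a ≥ 1` / `b ≥ 1`), `code_one_one_decode_radius_optimal` (the `[[2^m, 2^m−2m−2, 4]]` class: the explicit
  pair attains the optimal radius `1`), `code_16_6_4_decode_correctsUpTo`.

Column words: `shortCode`, `pointDecode` = definitions (construction as printed); all parameter / radius statements = proved.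
HONEST FRAMING: exact parameters, the Hamming-rule decoder and the information-theoretic radius only; nothing about transversal
`T` / `Z(π/2^k)` gates, triorthogonality, magic-state distillation, code conversion or thresholds. Whether the members beyond
`[[7,1,3]]`, `[[15,1,3]]` are tabulated in print is not asserted (Landahl–Cesare's Table is referenced, not reproduced).

## References

* [LandahlCesare2013] A. J. Landahl, C. Cesare, arXiv:1302.3240 (2013), §6 (held chunk p0012 L52–90: Def. 2 and the shortened codes).
* [AndersonDuclosCianciPoulin2014] J. T. Anderson, G. Duclos-Cianci, D. Poulin, PRL 113 (2014) 080501, arXiv:1403.2734 (held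
  chunk p0003: `QRM(m) = [[2^m−1,1,3]]`, Facts 1–6).
* [MacWilliamsSloane1977] Ch. 13 §3 Thms. 3–4 (held chunks p0306–p0309); Ch. 1 §7 (the Hamming syndrome rule, chunk p0030).
* [Steane1996Simple] A. M. Steane, §3 (single error correction of `[[2^r−1, 2^r−1−2r, 3]]`) — the `[[7,1,3]]` member.
* [Gottesman1997] §2.3 (distance `2t+1` corrects `t`) — the Q4 radius.
-/

namespace Literature.InformationTheory.QuantumCodes

open Finset Matrix Literature.InformationTheory.Coding Literature.InformationTheory.Coding.ReedMuller

namespace QRM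

variable {m : ℕ}

/-! ### Nonzero points, restriction, even extension -/

/-- The qubit set of the shortened codes: the `2^m − 1` NONZERO points of `𝔽₂^m`.
[cite: LandahlCesare2013, §6 (chunk p0012 L67-79: shortening removes the point where p(0) is evaluated)] -/
abbrev Pt (m : ℕ) : Type := {x : Fin m → ZMod 2 // x ≠ 0}

/-- There are `2^m − 1` nonzero points. [cite: LandahlCesare2013, §6 (chunk p0012 L80: "[[2^m − 1, 1]]")] -/
theorem card_pt (m : ℕ) : Fintype.card (Pt m) = 2 ^ m - 1 := by
  rw [Fintype.card_subtype_compl, Fintype.card_subtype_eq, Fintype.card_fun, ZMod.card, Fintype.card_fin]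

/-- Restriction of a word on `𝔽₂^m` to the nonzero points (puncturing at `0`). (definition)
[cite: LandahlCesare2013, §6 (chunk p0012 L69-73: puncturing)] -/
def restrict (g : (Fin m → ZMod 2) → ZMod 2) : Pt m → ZMod 2 := fun x => g x.1

/-- Extension of a word on the nonzero points by a prescribed value at `0`. (definition) [folklore] -/
def extend (v : Pt m → ZMod 2) (c : ZMod 2) : (Fin m → ZMod 2) → ZMod 2 :=
  fun x => if hx : x = 0 then c else v ⟨x, hx⟩

/-- The EVEN extension: the value at `0` is the parity of `v`, so that the extended word has even weight. (definition) [folklore] -/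
def evenExt (v : Pt m → ZMod 2) : (Fin m → ZMod 2) → ZMod 2 := extend v (∑ x, v x)

/-- Restricting an extension gives the word back. [folklore] -/
@[simp] private theorem restrict_extend (v : Pt m → ZMod 2) (c : ZMod 2) : restrict (extend v c) = v := by
  funext x
  simp [restrict, extend, x.2]

/-- The extension takes the prescribed value at `0`. [folklore] -/
@[simp] private theorem extend_zero (v : Pt m → ZMod 2) (c : ZMod 2) : extend v c 0 = c := by
  simp [extend]

/-- A word is the extension of its restriction by its value at `0`. [folklore] -/
private theorem extend_restrict (g : (Fin m → ZMod 2) → ZMod 2) : extend (restrict g) (g 0) = g := by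
  funext x
  by_cases hx : x = 0
  · subst hx; simp [extend]
  · simp [extend, restrict, hx]

/-- Restriction is additive. [folklore] -/
private theorem restrict_add (g g' : (Fin m → ZMod 2) → ZMod 2) : restrict (g + g') = restrict g + restrict g' := rfl

/-- Splitting a sum over `𝔽₂^m` into the point `0` and the nonzero points. [folklore] -/
private theorem sum_eq_add_sum_pt {M : Type*} [AddCommMonoid M] (f : (Fin m → ZMod 2) → M) :
    ∑ x, f x = f 0 + ∑ x : Pt m, f x.1 := by
  rw [← Finset.add_sum_erase _ _ (mem_univ (0 : Fin m → ZMod 2))]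
  congr 1
  exact Finset.sum_subtype (univ.erase 0) (fun x => by simp) f

/-- The even extension has even weight: `Σ_x evenExt v x = 0`. [folklore] -/
private theorem sum_evenExt (v : Pt m → ZMod 2) : ∑ x, evenExt v x = 0 := by
  rw [sum_eq_add_sum_pt, evenExt, extend_zero]
  have : ∑ x : Pt m, extend v (∑ x, v x) x.1 = ∑ x, v x := by
    refine sum_congr rfl fun x _ => ?_
    simp [extend, x.2]
  rw [this]
  exact CharTwo.add_self_eq_zero _

/-- A word of `ℛ(s,m)` with `s < m` has even weight, so it IS the even extension of its restriction. [cite: MacWilliamsSloane1977, Ch. 13 §3 p. 375 (chunk p0308 L22)] -/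
theorem evenExt_restrict_of_mem_code {s : ℕ} (hs : s < m) {g : (Fin m → ZMod 2) → ZMod 2}
    (hg : g ∈ ReedMuller.code s m) : evenExt (restrict g) = g := by
  have hsum := sum_eq_zero_of_mem_code hg hs
  rw [sum_eq_add_sum_pt] at hsum
  have h0 : ∑ x : Pt m, g x.1 = g 0 := by
    have : g 0 + g 0 = 0 := CharTwo.add_self_eq_zero _
    exact (add_left_cancel (hsum.trans this.symm)).symm ▸ rfl
  unfold evenExt
  rw [show (∑ x, restrict g x) = g 0 from h0, extend_restrict]

/-- The weight of a word splits as the weight of its restriction plus the contribution of the point `0`. [folklore] -/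
private theorem hammingNorm_eq_restrict (g : (Fin m → ZMod 2) → ZMod 2) :
    hammingNorm g = hammingNorm (restrict g) + (if g 0 = 0 then 0 else 1) := by
  classical
  unfold hammingNorm
  rw [card_filter, card_filter, sum_eq_add_sum_pt (fun x => if g x ≠ 0 then 1 else 0), add_comm]
  congr 1
  by_cases h : g 0 = 0 <;> simp [h]

/-! ### The shortened generator matrices -/

/-- The index set of the monomials of degree `1 … r` (no constant term): the rows of the shortened generator matrix of
`ℛ(r,m)`. [cite: LandahlCesare2013, §6 (chunk p0012 L76-77: "Boolean polynomials … which have no constant term")] -/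
abbrev MonoPos (m r : ℕ) : Type := {S : Finset (Fin m) // 0 < S.card ∧ S.card ≤ r}

/-- **The shortened generator matrix `ℛ̄(r,m)`**: rows = monomials of degree `1 … r`, columns = the nonzero points.
[cite: LandahlCesare2013, §6 (chunk p0012 L67-79)] -/
def shortGenMatrix (m r : ℕ) : Matrix (MonoPos m r) (Pt m) (ZMod 2) :=
  Matrix.of fun S x => monomialFun S.1 x.1

/-- A non-constant monomial vanishes at the point `0`. [folklore] -/
private theorem monomialFun_zero_of_nonempty {S : Finset (Fin m)} (hS : S.Nonempty) : monomialFun S 0 = 0 := by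
  obtain ⟨i, hi⟩ := hS
  exact prod_eq_zero hi rfl

/-- For a non-constant monomial, the dot product on the nonzero points equals the dot product on all points against ANY
extension (the monomial kills the point `0`). [folklore] -/
private theorem dotProduct_restrict_monomialFun {S : Finset (Fin m)} (hS : S.Nonempty) (v : Pt m → ZMod 2) (c : ZMod 2) :
    restrict (monomialFun S) ⬝ᵥ v = monomialFun S ⬝ᵥ extend v c := by
  unfold dotProduct
  rw [sum_eq_add_sum_pt (fun x => monomialFun S x * extend v c x), monomialFun_zero_of_nonempty hS, zero_mul,
    zero_add]
  refine sum_congr rfl fun x _ => ?_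
  simp [restrict, extend, x.2]

/-- The constant monomial pairs with a word to its parity. [folklore] -/
private theorem monomialFun_empty_dotProduct (g : (Fin m → ZMod 2) → ZMod 2) : monomialFun ∅ ⬝ᵥ g = ∑ x, g x := by
  unfold dotProduct monomialFun
  simp

/-- **The kernel of the shortened generator matrix** (`r + s + 1 = m`): `v ∈ ker ℛ̄(r,m)` iff the even extension of `v`
lies in `ℛ(s,m) = ℛ(r,m)^⊥` (MacWilliams–Sloane Ch. 13 Thm. 4 through the shortening).
[cite: MacWilliamsSloane1977, Ch. 13 §3 Thm. 4 (chunks p0308-p0309)] [cite: LandahlCesare2013, §6 (chunk p0012 L52-54)] -/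
theorem shortGenMatrix_mulVec_eq_zero_iff {r s : ℕ} (h : r + s + 1 = m) (v : Pt m → ZMod 2) :
    shortGenMatrix m r *ᵥ v = 0 ↔ evenExt v ∈ ReedMuller.code s m := by
  rw [mem_code_iff_forall_monomialFun h]
  constructor
  · intro hv S hS
    by_cases hS0 : S = ∅
    · subst hS0
      rw [monomialFun_empty_dotProduct, sum_evenExt]
    · have hne : S.Nonempty := nonempty_iff_ne_empty.2 hS0
      have := congr_fun hv ⟨S, card_pos.2 hne, hS⟩
      rw [Pi.zero_apply, mulVec] at this
      change restrict (monomialFun S) ⬝ᵥ v = 0 at this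
      rwa [dotProduct_restrict_monomialFun hne v] at this
  · intro hv
    funext S
    rw [Pi.zero_apply, mulVec]
    change restrict (monomialFun S.1) ⬝ᵥ v = 0
    rw [dotProduct_restrict_monomialFun (card_pos.1 S.2.1) v]
    exact hv S.1 S.2.2

/-- The support of an exponent vector has at most `|s|` elements. [folklore] -/
private theorem card_support_le_degree' (s : Fin m →₀ ℕ) : s.support.card ≤ s.sum fun _ e => e := by
  calc s.support.card = ∑ i ∈ s.support, 1 := by simp
    _ ≤ ∑ i ∈ s.support, s i :=
        sum_le_sum fun i hi => Nat.one_le_iff_ne_zero.2 (Finsupp.mem_support_iff.1 hi)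
    _ = s.sum fun _ e => e := rfl

/-- **The row space of the shortened generator matrix** = the restrictions of the words of `ℛ(r,m)` that vanish at `0`
("polynomials with no constant term and `p(0) = 0`").
[cite: LandahlCesare2013, §6 (chunk p0012 L74-78)] -/
theorem mem_rowSpace_shortGenMatrix_iff {r : ℕ} (v : Pt m → ZMod 2) :
    v ∈ rowSpace (shortGenMatrix m r) ↔ ∃ g ∈ ReedMuller.code r m, g 0 = 0 ∧ restrict g = v := by
  constructor
  · intro hv
    rw [rowSpace_eq_span_rows] at hv
    induction hv using Submodule.span_induction with
    | mem w hw =>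
      obtain ⟨S, rfl⟩ := hw
      exact ⟨monomialFun S.1, monomialFun_mem_code S.2.2, monomialFun_zero_of_nonempty (card_pos.1 S.2.1), rfl⟩
    | zero => exact ⟨0, Submodule.zero_mem _, rfl, rfl⟩
    | add u w _ _ hu hw =>
      obtain ⟨g, hg, hg0, rfl⟩ := hu
      obtain ⟨g', hg', hg0', rfl⟩ := hw
      exact ⟨g + g', Submodule.add_mem _ hg hg', by simp [hg0, hg0'], rfl⟩
    | smul c u _ hu =>
      obtain ⟨g, hg, hg0, rfl⟩ := hu
      exact ⟨c • g, Submodule.smul_mem _ c hg, by simp [hg0], rfl⟩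
  · rintro ⟨g, ⟨p, hp, hg⟩, hg0, rfl⟩
    have hcoeff0 : p.coeff 0 = 0 := by
      have h1 : MvPolynomial.eval (0 : Fin m → ZMod 2) p = MvPolynomial.constantCoeff p :=
        DFunLike.congr_fun MvPolynomial.eval_zero p
      rw [← hg 0, hg0, MvPolynomial.constantCoeff_eq] at h1
      exact h1.symm
    have hrestr : restrict g = ∑ s ∈ p.support, p.coeff s • restrict (monomialFun s.support) := by
      funext x
      rw [Finset.sum_apply]
      simp only [restrict, Pi.smul_apply, smul_eq_mul]
      rw [hg, eval_eq_sum_monomialFun]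
    rw [hrestr]
    refine Submodule.sum_mem _ fun s hs => ?_
    by_cases hs0 : s = 0
    · subst hs0
      rw [hcoeff0, zero_smul]
      exact Submodule.zero_mem _
    · refine Submodule.smul_mem _ _ ?_
      have hne : 0 < s.support.card := card_pos.2 (Finsupp.support_nonempty_iff.2 hs0)
      have hle : s.support.card ≤ r := (card_support_le_degree' s).trans ((MvPolynomial.le_totalDegree hs).trans hp)
      rw [rowSpace_eq_span_rows]
      exact Submodule.subset_span ⟨⟨s.support, hne, hle⟩, rfl⟩

/-- **Commutation** of the shortened `X`- and `Z`-check matrices for `a + b < m` (the product monomial has degree `≤ m − 1`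
and vanishes at `0`, so its weight on the nonzero points is its even weight on all points).
[cite: AndersonDuclosCianciPoulin2014, p. 3 Fact 4 (chunk p0003: "RM̄(1,m) is contained in the dual of RM̄(m−2,m)")] -/
theorem shortGenMatrix_mul_transpose {a b : ℕ} (h : a + b < m) :
    shortGenMatrix m a * (shortGenMatrix m b)ᵀ = 0 := by
  ext S T
  rw [Matrix.mul_apply, Matrix.zero_apply]
  change restrict (monomialFun S.1) ⬝ᵥ restrict (monomialFun T.1) = 0
  rw [dotProduct_restrict_monomialFun (card_pos.1 S.2.1) _ (monomialFun T.1 0), extend_restrict]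
  exact ReedMuller.dotProduct_eq_zero (monomialFun_mem_code S.2.2) (monomialFun_mem_code T.2.2) h

/-- The rows of the shortened generator matrix are linearly independent (a relation on the nonzero points extends to the
point `0`, where every non-constant monomial vanishes). [cite: MacWilliamsSloane1977, Ch. 13 §3 p. 373 (chunk p0306: linear independence of the monomials)] -/
theorem linearIndependent_shortGenMatrix (m r : ℕ) :
    LinearIndependent (ZMod 2) (fun S : MonoPos m r => shortGenMatrix m r S) := by
  rw [Fintype.linearIndependent_iff]
  intro g hg S
  have hli := (linearIndependent_monomialFun (m := m)).comp (fun S : MonoPos m r => S.1)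
    (fun S T hST => Subtype.ext hST)
  rw [Fintype.linearIndependent_iff] at hli
  refine hli g ?_ S
  funext x
  by_cases hx : x = 0
  · subst hx
    rw [Finset.sum_apply, Pi.zero_apply]
    refine sum_eq_zero fun T _ => ?_
    simp only [Function.comp_apply, Pi.smul_apply, smul_eq_mul]
    rw [monomialFun_zero_of_nonempty (card_pos.1 T.2.1), mul_zero]
  · have := congr_fun hg ⟨x, hx⟩
    rw [Finset.sum_apply, Pi.zero_apply] at this
    rw [Finset.sum_apply, Pi.zero_apply, ← this]
    refine sum_congr rfl fun T _ => ?_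
    rfl

/-- `|{S : 1 ≤ |S| ≤ r}| + 1 = Σ_{i≤r} C(m,i)` (the constant monomial removed). [folklore] -/
private theorem card_monoPos (m r : ℕ) : Fintype.card (MonoPos m r) + 1 = ∑ i ∈ range (r + 1), m.choose i := by
  classical
  rw [← card_monomials_le r m, Fintype.card_subtype, Fintype.card_subtype]
  have hsplit : (univ.filter fun S : Finset (Fin m) => S.card ≤ r) =
      insert ∅ (univ.filter fun S : Finset (Fin m) => 0 < S.card ∧ S.card ≤ r) := by
    ext S
    simp only [mem_filter, mem_univ, true_and, mem_insert, card_pos]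
    constructor
    · intro hS
      by_cases h0 : S = ∅
      · exact Or.inl h0
      · exact Or.inr ⟨nonempty_iff_ne_empty.2 h0, hS⟩
    · rintro (rfl | ⟨-, hS⟩)
      · simp
      · exact hS
  rw [hsplit, card_insert_of_notMem (by simp)]

/-- **Rank of the shortened generator matrix**: `rank ℛ̄(r,m) + 1 = Σ_{i≤r} C(m,i)`. [cite: LandahlCesare2013, §6 (chunk p0012 L69-73: expurgating removes one row)] -/
theorem rank_shortGenMatrix (m r : ℕ) : (shortGenMatrix m r).rank + 1 = ∑ i ∈ range (r + 1), m.choose i := by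
  rw [← finrank_rowSpace_eq_rank, rowSpace_eq_span_rows, finrank_span_eq_card (linearIndependent_shortGenMatrix m r),
    card_monoPos]

/-! ### The shortened quantum Reed–Muller code -/

/-- **The shortened quantum Reed–Muller code `\overline{QRM}(a,m)`** (`a + b + 1 = m`): the CSS code on the `2^m − 1`
nonzero points of `𝔽₂^m` with `X`-checks the shortened generator matrix of `ℛ(a,m)` and `Z`-checks the shortened generator
matrix of its dual `ℛ(b,m) = ℛ(m−a−1,m)`. For `a = 1` these are the codes `QRM(m) = [[2^m−1,1,3]]` of
Anderson–Duclos-Cianci–Poulin. (definition)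
[cite: LandahlCesare2013, §6 Def. 2 and the shortened codes (chunk p0012 L52-90)] [cite: AndersonDuclosCianciPoulin2014, p. 3 (chunk p0003)] -/
def shortCode (m a b : ℕ) (h : a + b + 1 = m) : CSSCode (MonoPos m a) (MonoPos m b) (Pt m) :=
  CSSCode.ofMatrices (shortGenMatrix m a) (shortGenMatrix m b) (shortGenMatrix_mul_transpose (by omega))

/-- The `X`-check matrix of the shortened code. [cite: LandahlCesare2013, §6 (chunk p0012 L58-61)] -/
theorem shortCode_HX {a b : ℕ} (h : a + b + 1 = m) : (shortCode m a b h).HX = shortGenMatrix m a := rfl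

/-- The `Z`-check matrix of the shortened code. [cite: LandahlCesare2013, §6 (chunk p0012 L58-61)] -/
theorem shortCode_HZ {a b : ℕ} (h : a + b + 1 = m) : (shortCode m a b h).HZ = shortGenMatrix m b := rfl

/-- **`k = 1`**: `k = (2^m − 1) − rank ℛ̄(a,m) − rank ℛ̄(b,m) = 2^m − 1 − (Σ_{i≤a} C(m,i) − 1) − (Σ_{i≤b} C(m,i) − 1) = 1`
by the dimension count `Σ_{i≤a} + Σ_{i≤b} = 2^m` of the duality theorem.
[cite: LandahlCesare2013, §6 (chunk p0012 L80: "The parameters of the resulting quantum code are [[2^m − 1, 1]]")] -/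
theorem shortCode_k {a b : ℕ} (h : a + b + 1 = m) : (shortCode m a b h).k = 1 := by
  rw [CSSCode.k_eq, card_pt, shortCode_HX, shortCode_HZ]
  have ha := rank_shortGenMatrix m a
  have hb := rank_shortGenMatrix m b
  have hab := sum_range_choose_add h
  have h1 : 1 ≤ 2 ^ m := Nat.one_le_two_pow
  omega

/-- **Lower bound on the logicals of the shortened pair** (`r + s + 1 = m`): a word of `ker ℛ̄(r,m)` outside `rs ℛ̄(s,m)` has
weight `≥ 2^{r+1} − 1` — its even extension is a word of `ℛ(s,m)` taking the value `1` at `0` (value `0` would put the word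
in the row space), hence of weight `≥ 2^{m−s} = 2^{r+1}`.
[cite: AndersonDuclosCianciPoulin2014, p. 3 (chunk p0003: "the minimum distance of the quantum code is given by the minimum distance of the dual classical code")] [cite: MacWilliamsSloane1977, Ch. 13 §3 Thm. 3 (chunk p0308)] -/
theorem le_hammingNorm_of_logical {r s : ℕ} (h : r + s + 1 = m) {v : Pt m → ZMod 2}
    (hker : shortGenMatrix m r *ᵥ v = 0) (hnot : v ∉ rowSpace (shortGenMatrix m s)) :
    2 ^ (r + 1) - 1 ≤ hammingNorm v := by
  have hg : evenExt v ∈ ReedMuller.code s m := (shortGenMatrix_mulVec_eq_zero_iff h v).1 hker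
  have hrestr : restrict (evenExt v) = v := restrict_extend v _
  have hg0 : evenExt v 0 ≠ 0 := fun h0 =>
    hnot ((mem_rowSpace_shortGenMatrix_iff v).2 ⟨evenExt v, hg, h0, hrestr⟩)
  have hgne : evenExt v ≠ 0 := fun h0 => hg0 (by rw [h0]; rfl)
  have hwt := ReedMullerMinDistance.two_pow_le_hammingNorm m s _ hg hgne
  rw [show m - s = r + 1 by omega, hammingNorm_eq_restrict, hrestr, if_neg hg0] at hwt
  omega

/-- **The minimum-weight logical of the shortened pair** (`r + s + 1 = m`): the restriction of `g = ∏_{i<s}(1 + x_i) ∈ ℛ(s,m)`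
(`g(0) = 1`, weight `2^{m−s} = 2^{r+1}`) lies in `ker ℛ̄(r,m) ∖ rs ℛ̄(s,m)` and has weight exactly `2^{r+1} − 1`.
[cite: AndersonDuclosCianciPoulin2014, p. 3 (chunk p0003: logical operators from the rows removed in the shortening)] [cite: MacWilliamsSloane1977, Ch. 13 §3 Thm. 3 (chunk p0308)] -/
theorem exists_logical {r s : ℕ} (h : r + s + 1 = m) :
    ∃ v : Pt m → ZMod 2, shortGenMatrix m r *ᵥ v = 0 ∧ v ∉ rowSpace (shortGenMatrix m s) ∧
      hammingNorm v = 2 ^ (r + 1) - 1 := by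
  classical
  -- the witness g = ∏_{i ∈ T} (1 + x_i), |T| = s
  let T : Finset (Fin m) := univ.map (Fin.castLEEmb (show s ≤ m by omega))
  have hT : T.card = s := by simp [T]
  let g : (Fin m → ZMod 2) → ZMod 2 := fun x => ∏ i ∈ T, (1 + x i)
  have hgdeg : g ∈ ReedMuller.code s m := by
    refine ⟨∏ i ∈ T, (1 + MvPolynomial.X i), ?_, fun x => ?_⟩
    · refine (MvPolynomial.totalDegree_finsetProd _ _).trans ?_
      calc ∑ i ∈ T, (1 + MvPolynomial.X i : MvPolynomial (Fin m) (ZMod 2)).totalDegree ≤ ∑ i ∈ T, 1 :=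
            sum_le_sum fun i _ => (MvPolynomial.totalDegree_add _ _).trans
              (max_le (by simp) (by rw [MvPolynomial.totalDegree_X]))
        _ = s := by simp [hT]
    · simp only [g, map_prod, map_add, map_one, MvPolynomial.eval_X]
  have hg0 : g 0 = 1 := by simp [g]
  have h01 : ∀ a : ZMod 2, a ≠ 1 → a = 0 := by decide
  have h10 : ∀ a : ZMod 2, 1 + a ≠ 0 ↔ a = 0 := by decide
  -- weight of g: the points with x_i = 0 on T
  have hgwt : hammingNorm g = 2 ^ (r + 1) := by
    have hset : (univ.filter fun x : Fin m → ZMod 2 => g x ≠ 0) =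
        Fintype.piFinset fun i => if i ∈ T then {0} else univ := by
      ext x
      simp only [mem_filter, mem_univ, true_and, Fintype.mem_piFinset, g]
      rw [prod_ne_zero_iff]
      constructor
      · intro hx i
        split_ifs with hi
        · exact mem_singleton.2 ((h10 _).1 (hx i hi))
        · exact mem_univ _
      · intro hx i hi
        have := hx i
        rw [if_pos hi] at this
        exact (h10 _).2 (mem_singleton.1 this)
    unfold hammingNorm
    rw [hset, Fintype.card_piFinset]
    have hf : ∀ i : Fin m, (if i ∈ T then ({0} : Finset (ZMod 2)) else univ).card = if i ∈ Tᶜ then 2 else 1 := by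
      intro i
      by_cases hi : i ∈ T
      · simp [hi]
      · simp [hi, ZMod.card]
    simp_rw [hf]
    rw [prod_ite_mem, univ_inter, prod_const, card_compl, Fintype.card_fin, hT, show m - s = r + 1 by omega]
  refine ⟨restrict g, ?_, ?_, ?_⟩
  · rw [shortGenMatrix_mulVec_eq_zero_iff h, evenExt_restrict_of_mem_code (by omega) hgdeg]
    exact hgdeg
  · rintro hmem
    obtain ⟨g', hg', hg'0, hrestr⟩ := (mem_rowSpace_shortGenMatrix_iff _).1 hmem
    -- g + g' ∈ ℛ(s,m) has weight exactly 1: impossible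
    have hd : g + g' ∈ ReedMuller.code s m := Submodule.add_mem _ hgdeg hg'
    have hd0 : (g + g') 0 ≠ 0 := by rw [Pi.add_apply, hg0, hg'0, add_zero]; exact one_ne_zero
    have hdr : restrict (g + g') = 0 := by
      rw [restrict_add, hrestr]; funext x; exact CharTwo.add_self_eq_zero _
    have hdwt : hammingNorm (g + g') = 1 := by
      rw [hammingNorm_eq_restrict, hdr, hammingNorm_zero, if_neg hd0]
    have hdne : g + g' ≠ 0 := fun h0 => hd0 (by rw [h0]; rfl)
    have hle := ReedMullerMinDistance.two_pow_le_hammingNorm m s _ hd hdne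
    rw [hdwt, show m - s = r + 1 by omega, pow_succ] at hle
    have : 1 ≤ 2 ^ r := Nat.one_le_two_pow
    omega
  · have := hammingNorm_eq_restrict g
    rw [hgwt, hg0, if_neg one_ne_zero] at this
    omega

/-- **`d_Z = 2^{a+1} − 1`** for the shortened code (`Z`-logicals = `ker ℛ̄(a) ∖ rs ℛ̄(b)`).
[cite: AndersonDuclosCianciPoulin2014, p. 3 (chunk p0003: "d = 3 (Fact 3)" for a = 1)] [cite: MacWilliamsSloane1977, Ch. 13 §3 Thms. 3-4 (chunks p0308-p0309)] -/
theorem shortCode_dZ {a b : ℕ} (h : a + b + 1 = m) : (shortCode m a b h).dZ = 2 ^ (a + 1) - 1 := by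
  obtain ⟨v, hv, hv', hwt⟩ := exists_logical (m := m) (r := a) (s := b) h
  exact (shortCode m a b h).dZ_eq_of_witness hv hv' hwt fun w hw hw' => le_hammingNorm_of_logical h hw hw'

/-- **`d_X = 2^{b+1} − 1`** for the shortened code (`X`-logicals = `ker ℛ̄(b) ∖ rs ℛ̄(a)`; for ADP14's `a = 1`, `b = m − 2`
this is `2^{m−1} − 1`, e.g. `7` for the 15-qubit code).
[cite: AndersonDuclosCianciPoulin2014, p. 3 (chunk p0003)] [cite: MacWilliamsSloane1977, Ch. 13 §3 Thms. 3-4 (chunks p0308-p0309)] -/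
theorem shortCode_dX {a b : ℕ} (h : a + b + 1 = m) : (shortCode m a b h).dX = 2 ^ (b + 1) - 1 := by
  obtain ⟨v, hv, hv', hwt⟩ := exists_logical (m := m) (r := b) (s := a) (by omega)
  exact (shortCode m a b h).dX_eq_of_witness hv hv' hwt fun w hw hw' => le_hammingNorm_of_logical (by omega) hw hw'

/-- ★ **Shortened quantum Reed–Muller codes: exact parameters.** For `a + b + 1 = m`, `\overline{QRM}(a,m)` is a
`[[2^m − 1, 1, 2^{min(a,b)+1} − 1]]` code (`d_Z = 2^{a+1} − 1`, `d_X = 2^{b+1} − 1`, both exact). (proved)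
[cite: LandahlCesare2013, §6 (chunk p0012 L80)] [cite: AndersonDuclosCianciPoulin2014, p. 3 (chunk p0003)] -/
theorem shortCode_isCode {a b : ℕ} (h : a + b + 1 = m) :
    (shortCode m a b h).IsCode (2 ^ m - 1) 1 (2 ^ (min a b + 1) - 1) := by
  have hmin : min (2 ^ (b + 1) - 1) (2 ^ (a + 1) - 1) = 2 ^ (min a b + 1) - 1 := by
    rcases le_total a b with hab | hab
    · have : 2 ^ (a + 1) ≤ 2 ^ (b + 1) := Nat.pow_le_pow_right (by norm_num) (by omega)
      rw [min_eq_right (by omega), min_eq_left hab]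
    · have : 2 ^ (b + 1) ≤ 2 ^ (a + 1) := Nat.pow_le_pow_right (by norm_num) (by omega)
      rw [min_eq_left (by omega), min_eq_right hab]
  have := (shortCode m a b h).isCode_of_dX_dZ (by rw [shortCode_k]; exact one_pos) (shortCode_dX h) (shortCode_dZ h)
  rwa [card_pt, shortCode_k, hmin] at this

/-- Parameters with caller-supplied numerals. [cite: LandahlCesare2013, §6 (chunk p0012 L80)] -/
theorem shortCode_isCode_of_eq {a b n d : ℕ} (h : a + b + 1 = m) (hn : 2 ^ m - 1 = n) (hd : 2 ^ (min a b + 1) - 1 = d) :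
    (shortCode m a b h).IsCode n 1 d := by
  rw [← hn, ← hd]
  exact shortCode_isCode h

/-- **Anderson–Duclos-Cianci–Poulin's family `QRM(m) = [[2^m − 1, 1, 3]]`** (`a = 1`, `b = m − 2`, every `m ≥ 3`; stated
with `1 + b + 1 = m`). [cite: AndersonDuclosCianciPoulin2014, p. 3 (chunk p0003: "[[n = 2^m − 1, k = 1, d = 3]]")] -/
theorem adp_isCode {b : ℕ} (h : 1 + b + 1 = m) (hb : 1 ≤ b) : (shortCode m 1 b h).IsCode (2 ^ m - 1) 1 3 :=
  shortCode_isCode_of_eq h rfl (by rw [min_eq_left hb]; norm_num)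

/-- **`[[7,1,3]]`**: `\overline{QRM}(1,3)`, Steane's code (`a = b = 1`). [cite: AndersonDuclosCianciPoulin2014, p. 3 (chunk p0003: "the first two instances … Steane's 7-qubit code")] -/
theorem shortCode_7_1_3 : (shortCode 3 1 1 rfl).IsCode 7 1 3 :=
  shortCode_isCode_of_eq (m := 3) (a := 1) (b := 1) rfl rfl rfl

/-- **`[[15,1,3]]`**: ADP14's 15-qubit Reed–Muller code (`m = 4`, `a = 1`, `b = 2`; `d_Z = 3`, `d_X = 7`).
[cite: AndersonDuclosCianciPoulin2014, p. 3 (chunk p0003: "a 15-qubit Reed-Muller code")] -/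
theorem shortCode_15_1_3 : (shortCode 4 1 2 rfl).IsCode 15 1 3 :=
  shortCode_isCode_of_eq (m := 4) (a := 1) (b := 2) rfl rfl rfl

/-- **`[[31,1,3]]`** (`m = 5`, `a = 1`, `b = 3`; `d_X = 15`). [cite: LandahlCesare2013, §6 (chunk p0012 L80-88)] -/
theorem shortCode_31_1_3 : (shortCode 5 1 3 rfl).IsCode 31 1 3 :=
  shortCode_isCode_of_eq (m := 5) (a := 1) (b := 3) rfl rfl rfl

/-- **`[[31,1,7]]`** (`m = 5`, `a = b = 2`: the self-dual-pair member `\overline{QRM}(2,5)`).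
[cite: LandahlCesare2013, §6 (chunk p0012 L80-88: "the length n does not uniquely specify which shortened QRM code")] -/
theorem shortCode_31_1_7 : (shortCode 5 2 2 rfl).IsCode 31 1 7 :=
  shortCode_isCode_of_eq (m := 5) (a := 2) (b := 2) rfl rfl rfl

/-- **`[[63,1,7]]`** (`m = 6`, `a = 2`, `b = 3`; `d_X = 15`). [cite: LandahlCesare2013, §6 (chunk p0012 L80-88)] -/
theorem shortCode_63_1_7 : (shortCode 6 2 3 rfl).IsCode 63 1 7 :=
  shortCode_isCode_of_eq (m := 6) (a := 2) (b := 3) rfl rfl rfl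

/-- **`[[127,1,15]]`** (`m = 7`, `a = b = 3`: `\overline{QRM}(3,7)`). [cite: LandahlCesare2013, §6 (chunk p0012 L80-88)] -/
theorem shortCode_127_1_15 : (shortCode 7 3 3 rfl).IsCode 127 1 15 :=
  shortCode_isCode_of_eq (m := 7) (a := 3) (b := 3) rfl rfl rfl

/-! ### Q4: the Hamming-rule decoder on the singleton-monomial syndrome bits -/

/-- The singleton `{i}` as a row index of `ℛ̄(r,m)`, `1 ≤ r`. (definition) [folklore] -/
def singletonRow {r : ℕ} (hr : 1 ≤ r) (i : Fin m) : MonoPos m r := ⟨{i}, by simp, by simpa using hr⟩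

/-- **The point decoder** (the Hamming rule): read the syndrome bits of the `m` coordinate monomials `x_0, …, x_{m−1}` as a
point `q ∈ 𝔽₂^m`; if `q = 0` answer `0`, else answer the single error at the qubit `q`. Computable. (definition)
[cite: MacWilliamsSloane1977, Ch. 1 §7 (chunk p0030: the syndrome "tells us which digit is in error")] [cite: AndersonDuclosCianciPoulin2014, p. 3 (chunk p0003: "it can correct any single qubit error")] -/
def pointDecode (r : ℕ) (hr : 1 ≤ r) : Decoder (MonoPos m r → ZMod 2) (Pt m → ZMod 2) := fun s =>
  if hq : (fun i => s (singletonRow hr i)) = 0 then 0 else Pi.single (⟨fun i => s (singletonRow hr i), hq⟩ : Pt m) 1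

/-- The point decoder is silent on the zero syndrome. [cite: MacWilliamsSloane1977, Ch. 1 §7 (chunk p0030)] -/
theorem pointDecode_zero (r : ℕ) (hr : 1 ≤ r) : pointDecode (m := m) r hr 0 = 0 := by
  unfold pointDecode
  rw [dif_pos]
  rfl

/-- The syndrome bit of the coordinate monomial `x_i` on the single error at `p` is `p_i`. [cite: MacWilliamsSloane1977, Ch. 1 §7 (chunk p0030)] -/
theorem shortGenMatrix_mulVec_single_singleton {r : ℕ} (hr : 1 ≤ r) (p : Pt m) (i : Fin m) :
    (shortGenMatrix m r *ᵥ Pi.single p 1) (singletonRow hr i) = p.1 i := by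
  rw [mulVec_single_one]
  change monomialFun {i} p.1 = p.1 i
  simp [monomialFun]

/-- **Route I**: on the syndrome of a single error the point decoder returns that error.
[cite: AndersonDuclosCianciPoulin2014, p. 3 (chunk p0003: "it can correct any single qubit error")] -/
theorem pointDecode_mulVec_single {r : ℕ} (hr : 1 ≤ r) (p : Pt m) :
    pointDecode r hr (shortGenMatrix m r *ᵥ Pi.single p 1) = Pi.single p 1 := by
  have hq : (fun i => (shortGenMatrix m r *ᵥ Pi.single p 1) (singletonRow hr i)) = p.1 := by
    funext i
    exact shortGenMatrix_mulVec_single_singleton hr p i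
  unfold pointDecode
  rw [dif_neg (by rw [hq]; exact p.2)]
  congr 1
  exact Subtype.ext hq

/-- On every pattern of weight `≤ 1` the point decoder returns the pattern itself.
[cite: AndersonDuclosCianciPoulin2014, p. 3 (chunk p0003)] -/
theorem pointDecode_mulVec_of_hammingNorm_le_one {r : ℕ} (hr : 1 ≤ r) {e : Pt m → ZMod 2} (he : hammingNorm e ≤ 1) :
    pointDecode r hr (shortGenMatrix m r *ᵥ e) = e := by
  rcases eq_zero_or_eq_single_of_hammingNorm_le_one he with rfl | ⟨p, rfl⟩
  · rw [mulVec_zero]; exact pointDecode_zero r hr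
  · exact pointDecode_mulVec_single hr p

/-- ★ **The point decoder corrects every `Z`-pattern of weight `≤ 1`** on `\overline{QRM}(a,m)` with `a ≥ 1` (phase flips are
read on the `X`-checks `ℛ̄(a,m)`). [cite: AndersonDuclosCianciPoulin2014, p. 3 (chunk p0003: "it can correct any single qubit error")] -/
theorem pointDecode_correctsUpTo_Z {a b : ℕ} (h : a + b + 1 = m) (ha : 1 ≤ a) :
    (pointDecode a ha).CorrectsUpTo (shortCode m a b h).zSyndrome
      ((shortCode m a b h).rowSpZ : Set (Pt m → ZMod 2)) hammingNorm 1 := by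
  intro e he
  show pointDecode a ha ((shortCode m a b h).zSyndrome e) + e ∈ ((shortCode m a b h).rowSpZ : Set (Pt m → ZMod 2))
  rw [CSSCode.zSyndrome, shortCode_HX, pointDecode_mulVec_of_hammingNorm_le_one ha he]
  have : e + e = 0 := by funext q; exact CharTwo.add_self_eq_zero _
  rw [this]
  exact (shortCode m a b h).rowSpZ.zero_mem

/-- ★ **The point decoder corrects every `X`-pattern of weight `≤ 1`** on `\overline{QRM}(a,m)` with `b ≥ 1` (bit flips are
read on the `Z`-checks `ℛ̄(b,m)`, which contain the coordinate monomials). [cite: AndersonDuclosCianciPoulin2014, p. 3 (chunk p0003)] -/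
theorem pointDecode_correctsUpTo_X {a b : ℕ} (h : a + b + 1 = m) (hb : 1 ≤ b) :
    (pointDecode b hb).CorrectsUpTo (shortCode m a b h).xSyndrome
      ((shortCode m a b h).rowSpX : Set (Pt m → ZMod 2)) hammingNorm 1 := by
  intro e he
  show pointDecode b hb ((shortCode m a b h).xSyndrome e) + e ∈ ((shortCode m a b h).rowSpX : Set (Pt m → ZMod 2))
  rw [CSSCode.xSyndrome_apply, shortCode_HZ, pointDecode_mulVec_of_hammingNorm_le_one hb he]
  have : e + e = 0 := by funext q; exact CharTwo.add_self_eq_zero _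
  rw [this]
  exact (shortCode m a b h).rowSpX.zero_mem

/-- ★ **For ADP14's `[[2^m − 1, 1, 3]]` the explicit point decoders ATTAIN the optimal radius `1`**: they correct every single
bit flip and every single phase flip, and no pair of sector decoders corrects all weight-`2` patterns of both kinds.
[cite: AndersonDuclosCianciPoulin2014, p. 3 (chunk p0003: "d = 3 … it can correct any single qubit error")] [cite: Gottesman1997, §2.3 (chunk p0014 L3)] -/
theorem adp_decode_radius_optimal {b : ℕ} (h : 1 + b + 1 = m) (hb : 1 ≤ b) :
    ((pointDecode b hb).CorrectsUpTo (shortCode m 1 b h).xSyndrome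
        ((shortCode m 1 b h).rowSpX : Set (Pt m → ZMod 2)) hammingNorm 1 ∧
      (pointDecode 1 le_rfl).CorrectsUpTo (shortCode m 1 b h).zSyndrome
        ((shortCode m 1 b h).rowSpZ : Set (Pt m → ZMod 2)) hammingNorm 1) ∧
    ∀ (DX : Decoder (MonoPos m b → ZMod 2) (Pt m → ZMod 2)) (DZ : Decoder (MonoPos m 1 → ZMod 2) (Pt m → ZMod 2))
      (t : ℕ), DX.CorrectsUpTo (shortCode m 1 b h).xSyndrome ((shortCode m 1 b h).rowSpX : Set (Pt m → ZMod 2)) hammingNorm t →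
        DZ.CorrectsUpTo (shortCode m 1 b h).zSyndrome ((shortCode m 1 b h).rowSpZ : Set (Pt m → ZMod 2)) hammingNorm t →
          t ≤ 1 :=
  ⟨⟨pointDecode_correctsUpTo_X h hb, pointDecode_correctsUpTo_Z h le_rfl⟩,
    fun _ _ _ hX hZ => (adp_isCode h hb).le_half_of_correctsUpTo_sectors hX hZ⟩

/-- **Q4 radius of the shortened family** (row 08): `\overline{QRM}(a,m)` (qubits renumbered `0 … 2^m − 2`) has OPTIMAL
Pauli-level correction radius `2^{min(a,b)} − 1` — attained by sector-wise minimum-weight decoding, unbeatable by any decoder.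
[cite: Gottesman1997, §2.3 (chunk p0014 L3)] -/
theorem shortCode_flatFin_hasOptimalRadius {a b : ℕ} (h : a + b + 1 = m) :
    (shortCode m a b h).flatFin.HasOptimalRadius (2 ^ min a b - 1) :=
  (shortCode_isCode h).flatFin_hasOptimalRadius (by
    have : 0 < 2 ^ min a b := Nat.two_pow_pos _
    rw [pow_succ]
    omega)

/-! ### Q4, explicit decoder (PARTITION row 08): the extended-Hamming rule on the members with degree-`1` checks

For `X`-checks `ℛ(1,m)` (the all-ones row and the `m` coordinate rows `x_0, …, x_{m−1}`), a single phase flip at the point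
`p ∈ 𝔽₂^m` has syndrome `1` on the all-ones row and `p_i` on the row `x_i`: the syndrome NAMES the point. The decoder below
reads it off — the decoding rule of the extended Hamming code `ℛ(m−2,m) = ℛ(1,m)^⊥` (MacWilliams–Sloane Ch. 1 §7 / Ch. 13 §3:
"`ℛ(1,m)` is always the dual of an extended Hamming code") — and so corrects every pattern of weight `≤ 1`, which is the
OPTIMAL sector radius of the `a = 1` members (`d_Z = 2^{a+1} = 4`). -/

/-- The row index of the constant monomial `1` (the all-ones check). (definition) [folklore] -/
def emptyRow (m r : ℕ) : Mono m r := ⟨∅, by simp⟩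

/-- The row index of the coordinate monomial `x_i`, `1 ≤ r`. (definition) [folklore] -/
def coordRow {r : ℕ} (hr : 1 ≤ r) (i : Fin m) : Mono m r := ⟨{i}, by simpa using hr⟩

/-- **The extended-Hamming-rule decoder**: if the all-ones syndrome bit is `0` answer `0` (no error, or an even-weight pattern
beyond the radius); otherwise answer the single error at the point whose coordinates are the syndrome bits of `x_0, …, x_{m−1}`.
Computable. (definition)
[cite: MacWilliamsSloane1977, Ch. 1 §7 (chunk p0030: the syndrome "tells us which digit is in error"); Ch. 13 §3 (chunk p0306: ℛ(1,m) is the dual of the extended Hamming code)] -/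
def extPointDecode (m r : ℕ) (hr : 1 ≤ r) : Decoder (Mono m r → ZMod 2) ((Fin m → ZMod 2) → ZMod 2) := fun s =>
  if s (emptyRow m r) = 0 then 0 else Pi.single (fun i => s (coordRow hr i)) 1

/-- The decoder is silent on the zero syndrome. [cite: MacWilliamsSloane1977, Ch. 1 §7 (chunk p0030)] -/
theorem extPointDecode_zero (m r : ℕ) (hr : 1 ≤ r) : extPointDecode m r hr 0 = 0 := by
  simp [extPointDecode]

/-- The all-ones check sees every single error: syndrome bit `1`. [cite: MacWilliamsSloane1977, Ch. 13 §3 (chunk p0306)] -/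
theorem genMatrix_mulVec_single_emptyRow {r : ℕ} (p : Fin m → ZMod 2) :
    (genMatrix m r *ᵥ Pi.single p 1) (emptyRow m r) = 1 := by
  rw [mulVec_single_one]
  change monomialFun ∅ p = 1
  simp [monomialFun]

/-- The coordinate check `x_i` reads the `i`-th coordinate of a single error's position. [cite: MacWilliamsSloane1977, Ch. 1 §7 (chunk p0030)] -/
theorem genMatrix_mulVec_single_coordRow {r : ℕ} (hr : 1 ≤ r) (p : Fin m → ZMod 2) (i : Fin m) :
    (genMatrix m r *ᵥ Pi.single p 1) (coordRow hr i) = p i := by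
  rw [mulVec_single_one]
  change monomialFun {i} p = p i
  simp [monomialFun]

/-- **Route I**: on the syndrome of a single error the decoder returns that error. [cite: MacWilliamsSloane1977, Ch. 1 §7 (chunk p0030)] -/
theorem extPointDecode_mulVec_single {r : ℕ} (hr : 1 ≤ r) (p : Fin m → ZMod 2) :
    extPointDecode m r hr (genMatrix m r *ᵥ Pi.single p 1) = Pi.single p 1 := by
  unfold extPointDecode
  rw [genMatrix_mulVec_single_emptyRow, if_neg one_ne_zero]
  congr 1
  funext i
  exact genMatrix_mulVec_single_coordRow hr p i

/-- On every pattern of weight `≤ 1` the decoder returns the pattern itself. [cite: MacWilliamsSloane1977, Ch. 1 §7 (chunk p0030)] -/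
theorem extPointDecode_mulVec_of_hammingNorm_le_one {r : ℕ} (hr : 1 ≤ r) {e : (Fin m → ZMod 2) → ZMod 2}
    (he : hammingNorm e ≤ 1) : extPointDecode m r hr (genMatrix m r *ᵥ e) = e := by
  classical
  rcases eq_zero_or_eq_single_of_hammingNorm_le_one he with rfl | ⟨p, rfl⟩
  · rw [mulVec_zero]; exact extPointDecode_zero m r hr
  · exact extPointDecode_mulVec_single hr p

/-- ★ **The decoder corrects every `Z`-pattern of weight `≤ 1`** on `QRM(m; a, b)` with `a ≥ 1` (phase flips are read on the
`X`-checks `ℛ(a,m) ⊇ ℛ(1,m)`). [cite: MacWilliamsSloane1977, Ch. 1 §7 (chunk p0030)] [cite: NielsenChuang2010, §10.4.2 (p. 450: CSS codes correct with the classical decoders)] -/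
theorem extPointDecode_correctsUpTo_Z {a b : ℕ} (h : a + b < m) (ha : 1 ≤ a) :
    (extPointDecode m a ha).CorrectsUpTo (code m a b h).zSyndrome
      ((code m a b h).rowSpZ : Set ((Fin m → ZMod 2) → ZMod 2)) hammingNorm 1 := by
  intro e he
  show extPointDecode m a ha ((code m a b h).zSyndrome e) + e ∈ ((code m a b h).rowSpZ : Set ((Fin m → ZMod 2) → ZMod 2))
  rw [CSSCode.zSyndrome, code_HX, extPointDecode_mulVec_of_hammingNorm_le_one ha he]
  have : e + e = 0 := by funext q; exact CharTwo.add_self_eq_zero _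
  rw [this]
  exact (code m a b h).rowSpZ.zero_mem

/-- ★ **The decoder corrects every `X`-pattern of weight `≤ 1`** on `QRM(m; a, b)` with `b ≥ 1` (bit flips are read on the
`Z`-checks `ℛ(b,m) ⊇ ℛ(1,m)`). [cite: MacWilliamsSloane1977, Ch. 1 §7 (chunk p0030)] [cite: NielsenChuang2010, §10.4.2 (p. 450)] -/
theorem extPointDecode_correctsUpTo_X {a b : ℕ} (h : a + b < m) (hb : 1 ≤ b) :
    (extPointDecode m b hb).CorrectsUpTo (code m a b h).xSyndrome
      ((code m a b h).rowSpX : Set ((Fin m → ZMod 2) → ZMod 2)) hammingNorm 1 := by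
  intro e he
  show extPointDecode m b hb ((code m a b h).xSyndrome e) + e ∈ ((code m a b h).rowSpX : Set ((Fin m → ZMod 2) → ZMod 2))
  rw [CSSCode.xSyndrome_apply, code_HZ, extPointDecode_mulVec_of_hammingNorm_le_one hb he]
  have : e + e = 0 := by funext q; exact CharTwo.add_self_eq_zero _
  rw [this]
  exact (code m a b h).rowSpX.zero_mem

/-- ★ **For the `a = b = 1` class `[[2^m, 2^m − 2m − 2, 4]]` (`m ≥ 4`) the explicit decoders ATTAIN the optimal radius `1`**:
they correct every single bit flip and every single phase flip, and no pair of sector decoders corrects all weight-`2` patterns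
of both kinds (`d = 4`). [cite: Gottesman1997, §2.3 (chunk p0014 L3: distance 2t+1 corrects t)] [cite: MacWilliamsSloane1977, Ch. 1 §7 (chunk p0030)] -/
theorem code_one_one_decode_radius_optimal (hm : 4 ≤ m) :
    ((extPointDecode m 1 le_rfl).CorrectsUpTo (code m 1 1 (by omega)).xSyndrome
        ((code m 1 1 (by omega)).rowSpX : Set ((Fin m → ZMod 2) → ZMod 2)) hammingNorm 1 ∧
      (extPointDecode m 1 le_rfl).CorrectsUpTo (code m 1 1 (by omega)).zSyndrome
        ((code m 1 1 (by omega)).rowSpZ : Set ((Fin m → ZMod 2) → ZMod 2)) hammingNorm 1) ∧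
    ∀ (DX DZ : Decoder (Mono m 1 → ZMod 2) ((Fin m → ZMod 2) → ZMod 2)) (t : ℕ),
      DX.CorrectsUpTo (code m 1 1 (by omega)).xSyndrome ((code m 1 1 (by omega)).rowSpX : Set ((Fin m → ZMod 2) → ZMod 2))
          hammingNorm t →
        DZ.CorrectsUpTo (code m 1 1 (by omega)).zSyndrome ((code m 1 1 (by omega)).rowSpZ : Set ((Fin m → ZMod 2) → ZMod 2))
          hammingNorm t → t ≤ 1 :=
  ⟨⟨extPointDecode_correctsUpTo_X _ le_rfl, extPointDecode_correctsUpTo_Z _ le_rfl⟩,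
    fun _ _ _ hX hZ => (code_one_one_isCode hm).le_half_of_correctsUpTo_sectors hX hZ⟩

/-- `[[16, 6, 4]]`: the explicit decoders correct every single bit flip and every single phase flip.
[cite: MacWilliamsSloane1977, Ch. 1 §7 (chunk p0030)] -/
theorem code_16_6_4_decode_correctsUpTo :
    (extPointDecode 4 1 le_rfl).CorrectsUpTo (code 4 1 1 (by norm_num)).xSyndrome
        ((code 4 1 1 (by norm_num)).rowSpX : Set ((Fin 4 → ZMod 2) → ZMod 2)) hammingNorm 1 ∧
      (extPointDecode 4 1 le_rfl).CorrectsUpTo (code 4 1 1 (by norm_num)).zSyndrome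
        ((code 4 1 1 (by norm_num)).rowSpZ : Set ((Fin 4 → ZMod 2) → ZMod 2)) hammingNorm 1 :=
  (code_one_one_decode_radius_optimal (m := 4) le_rfl).1

end QRM

end Literature.InformationTheory.QuantumCodes
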